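import Summits.CriticalPhenomena.CardyFormulaZ2.Theorems.CardyComplexConeCoherentMoreraKirchhoffCycleExtreme
import Summits.CriticalPhenomena.CardyFormulaZ2.Theorems.CardyComplexConeCoherentMoreraKirchhoffBoundaryOutside
import Literature.Probability.LatticeModels.SHolomorphicityProof
import Literature.Probability.LatticeModels.MedialCycleHopf

/-!
# The signed turning numbers of the spliced loop and of the excised stretch (Jordan carriers)
(helper for stub `stub_kirchhoff` of line `finitary-green-pairing`, crux `CoherentMorera`, stmt-CriticalPhenomena-11388)

In Smirnov's pairing `ω ↔ ω ∆ {e}` at a closed interior edge `e = cTgt p` of the exploration of discrete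
Dobrushin data on the carrier of a JORDAN domain:

* `turnSum_loop_eq_four` (case 1: `p` arrives, its partner never): the loop `L` of the partner under the
  ORIGINAL rule, which crosses `e`, has turning number `+4`;
* `turnSum_excised_eq_neg_four` (case 2: both arrive, `p` first): the excised stretch, a cycle of the
  TOGGLED rule following `e`, has turning number `-4`.

Proof (the orientation input of Duminil-Copin 2012, Prop. 4 at spin `1/3`): by the signed Umlaufsatz
in winding-number form (`cycleTurning_signed`) the wrong sign would force winding number `0` of every
corner vertex of `L` (resp. non-zero winding number of every corner vertex of the excised cycle); but the
vertex `x` of `p` is joined by open edges, along the exploration, to the start vertex, a corner of the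
non-inner face across `e_a`, which is OUTSIDE every cycle of inner corners (`boundaryOutside_wind_zero`,
from the hole-freeness of the inner faces of a Jordan carrier), so `x` has winding number `0`; in case 1
the jump across the crossed edge (`cycleWinding_jump`) then gives the partner's vertex non-zero winding
number, and in case 2 `x` itself is a corner vertex of the excised cycle.  The annulus with marks on the
hole (refuted-misstated item stmt-CriticalPhenomena-11306) shows that the Jordan hypothesis is needed.
-/

noncomputable section

namespace Summit.CriticalPhenomena.CardyFormulaZ2.Cruxes.CoherentMorera.FinitaryGreenPairing

open Literature.Topology.PlaneTopology Literature.Probability.LatticeModels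
open Literature.Probability.Percolation (BondConfig)

section Signs

variable {D : Literature.Probability.RandomPlanarGeometry.DobrushinDomain} {E : DiscreteDobrushin}
  {ω ω' : BondConfig (Site 2)} {c₀ p : Site 2 × Fin 4}

/-- **Case 1: the spliced loop turns by `+4`.**  Setting of `kSum_case1_eval`: `p = orb i₁` arrives at the
closed interior edge `e = cTgt p` of the exploration of `ω`, its partner never does, and `L` is the cycle of
the partner under the original rule, of minimal period `Q`. -/
theorem turnSum_loop_eq_four (hΩ : E.Ω = D.carrier) (hD : E.IsZdAdmissible) (hc₀ : E.IsStartCorner c₀)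
    (hagree : ∀ e, e ≠ cTgt p → (e ∈ E.bcBondConfig ω' ↔ e ∈ E.bcBondConfig ω))
    (hdiff : ¬ (cTgt p ∈ E.bcBondConfig ω' ↔ cTgt p ∈ E.bcBondConfig ω)) (he : cTgt p ∉ E.bcBondConfig ω)
    (hx : ∀ j, E.IsInnerFace (faceAt p.1 j)) (hy : ∀ j, E.IsInnerFace (faceAt (p.1 + cornerUnit (p.2 + 1)) j))
    {N P Q i₁ : ℕ} (hN : ¬ E.IsInnerFace (cFace (cornerOrbit (E.bcBondConfig ω) c₀ N)))
    (hlt : ∀ k < N, E.IsInnerFace (cFace (cornerOrbit (E.bcBondConfig ω) c₀ k)))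
    (hP0 : 0 < P) (hP : cornerOrbit (E.bcBondConfig ω) c₀ P = c₀)
    (hPmin : ∀ s, 0 < s → s < P → cornerOrbit (E.bcBondConfig ω) c₀ s ≠ c₀)
    (hQ0 : 0 < Q) (hQ : cornerOrbit (E.bcBondConfig ω) (cornerPartner p) Q = cornerPartner p)
    (hQmin : ∀ s, 0 < s → s < Q → cornerOrbit (E.bcBondConfig ω) (cornerPartner p) s ≠ cornerPartner p)
    (hi₁ : cornerOrbit (E.bcBondConfig ω) c₀ i₁ = p) (hi₁N : i₁ < N)
    (h₂ : ∀ i < N, cornerOrbit (E.bcBondConfig ω) c₀ i ≠ cornerPartner p) :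
    ∑ m ∈ Finset.range Q, turnSign (E.bcBondConfig ω) (cornerOrbit (E.bcBondConfig ω) (cornerPartner p) m) = 4 := by
  classical
  set β := E.bcBondConfig ω with hβ
  set p₂ := cornerPartner p with hp₂
  have hβE : β ⊆ (zdGraph 2).edgeSet := bcBondConfig_subset_zd ω
  -- the loop never meets the interface cycle; its corners are inner
  have hdisj : ∀ m s, cornerOrbit β p₂ m ≠ cornerOrbit β c₀ s := fun m s =>
    loop_ne_of_never_arrives hD hc₀ hy hN hlt hP0 hP hPmin h₂ m s
  obtain ⟨-, hloop, -, hin', -⟩ := cornerOrbit_toggle_case1 hD hc₀ hagree hdiff hx hy hN hlt hP0 hP hPmin hQ0 hQ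
    hQmin hi₁ hi₁N h₂
  have hinner : ∀ m, E.IsInnerFace (cFace (cornerOrbit β p₂ m)) := by
    intro m
    rw [← cornerOrbit_mod_period hQ m]
    have hlt' : m % Q < Q := Nat.mod_lt m hQ0
    rcases Nat.eq_zero_or_pos (m % Q) with h0 | hpos
    · rw [h0]; exact hy _
    · have h := hloop (m % Q - 1) (by omega)
      rw [show m % Q - 1 + 1 = m % Q by omega] at h
      rw [← h]
      exact hin' _ (by omega)
  -- period at least two
  have hQ2 : 2 ≤ Q := by
    by_contra hlt2
    have hQ1 : Q = 1 := by omega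
    rw [hQ1] at hQ
    exact nextCorner_ne_self β p₂ hQ
  obtain ⟨n, rfl⟩ : ∃ n, Q = n + 1 := ⟨Q - 1, by omega⟩
  -- the turning number is `±4`; exclude `-4`
  rcases medialCycle_turning_holds β p₂ (n + 1) hQ0 hQ hQmin with h4 | hm4
  · exact h4
  · exfalso
    obtain ⟨hzero, -⟩ := cycleTurning_signed β p₂ n hQ hβE (by omega) hQmin
    -- the partner's vertex has winding number zero …
    have hy0 := hzero hm4 0
    -- … the vertex of `p` too: it is joined to the start vertex, which is outside
    have hjump := cycleWinding_jump β p₂ n hQ hQmin 0 (Nat.zero_le _)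
      (show cTgt (cornerOrbit β p₂ 0) ∉ β by change cTgt p₂ ∉ β; rwa [hp₂, cTgt_partner])
      (fun m h => by
        change cornerOrbit β p₂ m = cornerPartner p₂ at h
        rw [hp₂, partner_partner] at h
        exact hdisj m i₁ (h.trans hi₁.symm))
    have hx0 : wind (fun t => (cyLoop n hQ).extend t - Site.toComplex (cornerPartner (cornerOrbit β p₂ 0)).1) = 0 := by
      have hreach : (Literature.Probability.Percolation.openGraph β).Reachable c₀.1 p.1 := by
        have := cornerOrbit_fst_reachable β c₀ (Nat.zero_le i₁)
        rwa [hi₁] at this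
      have hstart : wind (fun t => (cyLoop n hQ).extend t - Site.toComplex c₀.1) = 0 :=
        boundaryOutside_wind_zero D.toJordanDomain E hΩ hD.delta_pos β p₂ n hQ hinner c₀.1 (c₀.2 + 3) hc₀.isOutEdge.2
      have heq := wind_cyLoop_eq_of_reachable hβE hQ hreach
      have hpp : (cornerPartner p₂).1 = p.1 := by rw [hp₂, partner_partner]
      change wind (fun t => (cyLoop n hQ).extend t - Site.toComplex (cornerPartner p₂).1) = 0
      rw [hpp, ← heq, hstart]
    exact hjump (hy0.trans hx0.symm)

/-- **Case 2: the excised stretch turns by `-4`.**  Setting of `kSum_case2_eval`: both corners arrive at the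
closed interior edge `e = cTgt p` of the exploration of `ω`, `p = orb i₁` before its partner `orb i₂`; the
stretch `orb (i₁+1) … orb i₂` is a cycle of the TOGGLED rule of minimal period `i₂ - i₁` following `e`. -/
theorem turnSum_excised_eq_neg_four (hΩ : E.Ω = D.carrier) (hD : E.IsZdAdmissible) (hc₀ : E.IsStartCorner c₀)
    (hagree : ∀ e, e ≠ cTgt p → (e ∈ E.bcBondConfig ω' ↔ e ∈ E.bcBondConfig ω))
    (hdiff : ¬ (cTgt p ∈ E.bcBondConfig ω' ↔ cTgt p ∈ E.bcBondConfig ω)) (he : cTgt p ∉ E.bcBondConfig ω)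
    {N i₁ i₂ : ℕ} (hlt : ∀ k < N, E.IsInnerFace (cFace (cornerOrbit (E.bcBondConfig ω) c₀ k)))
    (hi₁ : cornerOrbit (E.bcBondConfig ω) c₀ i₁ = p) (hi₂ : cornerOrbit (E.bcBondConfig ω) c₀ i₂ = cornerPartner p)
    (h12 : i₁ < i₂) (hi₂N : i₂ < N) :
    ∑ m ∈ Finset.range (i₂ - i₁), turnSign (E.bcBondConfig ω')
      (cornerOrbit (E.bcBondConfig ω') (cornerOrbit (E.bcBondConfig ω) c₀ (i₁ + 1)) m) = -4 := by
  classical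
  set β := E.bcBondConfig ω with hβ
  set β' := E.bcBondConfig ω' with hβ'
  have hβE' : β' ⊆ (zdGraph 2).edgeSet := bcBondConfig_subset_zd ω'
  have he' : cTgt p ∈ β' := by
    by_contra h; exact hdiff ⟨fun h' => absurd h' h, fun h' => absurd h' he⟩
  have hinj : ∀ a b, a < N → b < N → cornerOrbit β c₀ a = cornerOrbit β c₀ b → a = b := by
    intro a b ha hb h
    by_contra hne
    rcases Nat.lt_or_gt_of_ne hne with hab | hab
    · exact cornerOrbit_ne hD hc₀ hab (fun k hk => hlt k (by omega)) h
    · exact cornerOrbit_ne hD hc₀ hab (fun k hk => hlt k (by omega)) h.symm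
  obtain ⟨hpre, -⟩ := cornerOrbit_toggle_case2 hD hc₀ hagree hdiff hlt hi₁ hi₂ h12 hi₂N
  -- the excised loop is a cycle of the toggled rule from `orb (i₁+1)`
  set q₂ := cornerOrbit β c₀ (i₁ + 1) with hq₂
  have hcyc : ∀ m, m + 1 ≤ i₂ - i₁ → cornerOrbit β' q₂ m = cornerOrbit β c₀ (i₁ + 1 + m) := by
    intro m hm
    induction m with
    | zero => rfl
    | succ m ih =>
      change nextCorner β' (cornerOrbit β' q₂ m) = _
      rw [ih (by omega), show i₁ + 1 + (m + 1) = (i₁ + 1 + m) + 1 by omega, cornerOrbit_succ]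
      refine nextCorner_toggle_of_ne hagree hdiff (fun h => ?_) (fun h => ?_)
      · have := hinj _ i₁ (by omega) (by omega) (h.trans hi₁.symm); omega
      · have := hinj _ i₂ (by omega) hi₂N (h.trans hi₂.symm); omega
  set M := i₂ - i₁ with hM
  have hM0 : 0 < M := by omega
  have hclose : cornerOrbit β' q₂ M = q₂ := by
    rw [show M = (M - 1) + 1 by omega]
    change nextCorner β' (cornerOrbit β' q₂ (M - 1)) = _
    rw [hcyc (M - 1) (by omega), show i₁ + 1 + (M - 1) = i₂ by omega, hi₂, nextCorner_toggle hagree hdiff,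
      Equiv.swap_apply_right, ← hi₁, ← cornerOrbit_succ]
  have hmin : ∀ s, 0 < s → s < M → cornerOrbit β' q₂ s ≠ q₂ := by
    intro s hs hsM h
    rw [hcyc s (by omega)] at h
    have := hinj _ _ (by omega) (by omega) h
    omega
  -- its corners are corners of the original exploration before time `i₂ + 1 ≤ N`, hence inner
  have hinner : ∀ m, E.IsInnerFace (cFace (cornerOrbit β' q₂ m)) := by
    intro m
    rw [← cornerOrbit_mod_period hclose m]
    have hltM : m % M < M := Nat.mod_lt m hM0
    rw [hcyc (m % M) (by omega)]
    exact hlt _ (by omega)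
  -- period at least two
  have hM2 : 2 ≤ M := by
    by_contra hlt2
    have hM1 : M = 1 := by omega
    have h := hclose
    rw [hM1] at h
    exact nextCorner_ne_self β' q₂ h
  obtain ⟨n, hn⟩ : ∃ n, M = n + 1 := ⟨M - 1, by omega⟩
  have hclose' : cornerOrbit β' q₂ (n + 1) = q₂ := by rw [← hn]; exact hclose
  have hmin' : ∀ s, 0 < s → s < n + 1 → cornerOrbit β' q₂ s ≠ q₂ := by rw [← hn]; exact hmin
  -- the turning number is `±4`; exclude `+4`
  rcases medialCycle_turning_holds β' q₂ M hM0 hclose hmin with h4 | hm4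
  · exfalso
    rw [hn] at h4
    obtain ⟨-, hne⟩ := cycleTurning_signed β' q₂ n hclose' hβE' (by omega) hmin'
    -- the vertex of `q₂ = nextCorner β p = (p.1, p.2 + 1)` is the vertex `x` of `p`, with winding number ≠ 0 …
    have hx := hne h4 0
    have hq₂x : (cornerOrbit β' q₂ 0).1 = p.1 := by
      change q₂.1 = p.1
      rw [hq₂, cornerOrbit_succ, hi₁, nextCorner_of_not_mem he]
    rw [hq₂x] at hx
    -- … but it is joined along the toggled exploration to the start vertex, which is outside
    have hreach : (Literature.Probability.Percolation.openGraph β').Reachable c₀.1 p.1 := by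
      have := cornerOrbit_fst_reachable β' c₀ (Nat.zero_le i₁)
      rwa [hpre i₁ le_rfl, hi₁] at this
    have hstart : wind (fun t => (cyLoop n hclose').extend t - Site.toComplex c₀.1) = 0 :=
      boundaryOutside_wind_zero D.toJordanDomain E hΩ hD.delta_pos β' q₂ n hclose' hinner c₀.1 (c₀.2 + 3)
        hc₀.isOutEdge.2
    have heq := wind_cyLoop_eq_of_reachable hβE' hclose' hreach
    exact hx (heq ▸ hstart)
  · exact hm4

end Signs

/-- **Signed turning of the excised stretch, registered form** (glue sub-goal `kirchhoffSignedTurns` of the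
line; explicit binders). -/
theorem kirchhoffSignedTurns : ∀ (D : Literature.Probability.RandomPlanarGeometry.DobrushinDomain) (E : DiscreteDobrushin) (ω ω' : BondConfig (Site 2)) (c₀ p : Site 2 × Fin 4) (N i₁ i₂ : ℕ), E.Ω = D.carrier → E.IsZdAdmissible → E.IsStartCorner c₀ → (∀ e, e ≠ cTgt p → (e ∈ E.bcBondConfig ω' ↔ e ∈ E.bcBondConfig ω)) → ¬ (cTgt p ∈ E.bcBondConfig ω' ↔ cTgt p ∈ E.bcBondConfig ω) → cTgt p ∉ E.bcBondConfig ω → (∀ k < N, E.IsInnerFace (cFace (cornerOrbit (E.bcBondConfig ω) c₀ k))) → cornerOrbit (E.bcBondConfig ω) c₀ i₁ = p → cornerOrbit (E.bcBondConfig ω) c₀ i₂ = cornerPartner p → i₁ < i₂ → i₂ < N → ∑ m ∈ Finset.range (i₂ - i₁), turnSign (E.bcBondConfig ω') (cornerOrbit (E.bcBondConfig ω') (cornerOrbit (E.bcBondConfig ω) c₀ (i₁ + 1)) m) = -4 :=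
  fun _ _ _ _ _ _ _ _ _ hΩ hD hc₀ hagree hdiff he hlt hi₁ hi₂ h12 hi₂N =>
    turnSum_excised_eq_neg_four hΩ hD hc₀ hagree hdiff he hlt hi₁ hi₂ h12 hi₂N

end Summit.CriticalPhenomena.CardyFormulaZ2.Cruxes.CoherentMorera.FinitaryGreenPairing

end
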